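import Literature.NumberTheory.Automorphic.ArthurClozelCuspidalDescentCharacterIdentity
import HarnessLib

/-!
# Arthur–Clozel, Ch. 3, Thm. 4.2 (d), existence clause: decomposition — the trace-formula input

Fact-decomposition file (librarian, mode `fact-decompose`, 2026-08-16) for the named fact
`Literature.NumberTheory.Automorphic.ArthurClozel1989_exists_cuspidal_descent_of_isGalStable`
(`AutomorphicGaloisConj.lean`; J. Arthur, L. Clozel, *Simple algebras, base change, and the
advanced theory of the trace formula*, Ann. of Math. Stud. 120 (1989), Ch. 3, Thm. 4.2 (d),
existence clause: for `E/F` cyclic of prime degree, a `σ`-stable cuspidal `Π` on `GL_n(𝔸_E)` is a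
weak base-change lift of a cuspidal `π` on `GL_n(𝔸_F)`).

The printed proof (Ch. 3, §4, pp. 206–207 with pp. 204–205) reads the identity of trace formulae
(4.1) = (4.2) (Ch. 2, Thms. A, B, (17.8)) as an identity of finite linear combinations of
characters of the unramified Hecke algebra `ℋ_E^S`, extracts a `π` by linear independence of
characters, and shows `π` cuspidal by the `L`-function argument (Jacquet–Shalika (2.2), (2.3)).
Everything after the trace identity is PROVED in the tree, for every rank `n`
(`arthurClozel1989_exists_cuspidal_descent_of_isGalStable_of_heckeCharacter_identity_cpow`,
`ArthurClozelCuspidalDescentCharacterIdentity.lean`, with its prequels `…HeckeCharacters`,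
`…Isobaric*`, `…IsobaricPairing`). Its remaining hypotheses are

* the Jacquet–Shalika facts (2.2) (three renderings), (2.3) over `F` in all ranks and (2.3) over
  `E` in rank `n`, and multiplicity one on `L²_cusp(GL_k(𝔸_F))` — all ALREADY named facts of the
  tree (`JacquetShalika1981_partialPairL_boundary_of_ne_one`, `…_at_one_of_rank_ne`,
  `…_at_one_of_ne_conj`, `…_pole_of_eq_conj` in `PairLFunctionPoles.lean`; `multiplicity_one_gl`),
  kept as hypotheses of the assembly and not restated; and
* `hspec`, the output of the comparison of trace formulae for one `σ`-stable cuspidal `Π` — the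
  ONE new child `ArthurClozel1989_traceIdentity_heckeCharacters` below (Arthur–Clozel, Ch. 3,
  (4.1) = (4.2) with the bookkeeping of its terms: Langlands' classification, Proc. Sympos. Pure
  Math. 33 (1979) Part 1, Prop. 2, on the `GL_n(𝔸_F)` side; isolation and non-vanishing of the term
  of `Π` on the twisted side, Jacquet–Shalika (2.4); i.e. the twisted trace formula of Ch. 2,
  Thms. A and B, (17.8) — the part of the book with no counterpart in the tree).

`ArthurClozel1989_exists_cuspidal_descent_of_isGalStable_holds_of` PROVES the parent from the child
and the existing facts. The child does not restate the parent: it is a spectral identity with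
complex shifts and isobaric data on the `F`-side, from which the parent follows only through the
proved extraction and `L`-function steps (and conversely a cuspidal descent yields such a datum
trivially, `exists_heckeCharacterIdentity_cpow_of_isWeakBaseChangeLift`, so the child asks for no
more than the book proves).

## References

* J. Arthur, L. Clozel, Ann. of Math. Stud. 120 (1989): Ch. 2, Thms. A, B, (17.8); Ch. 3, §1
  Def. 1.1, §2 (2.1)–(2.4), (4.1), (4.2), Thm. 4.2 (d) and its proof (pp. 203–207).
  [ArthurClozelAMS120]
* R. P. Langlands, Proc. Sympos. Pure Math. 33 (1979), Part 1, 203–207, Prop. 2.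
  [LanglandsCorvallis1979Notion]
* H. Jacquet, J. A. Shalika, Amer. J. Math. 103 (1981), I Thm. 5.3; II Prop. 3.6, Thm. 4.4.
  [JacquetShalikaAJM1981] [JacquetShalikaAJM1981II]
-/

noncomputable section

open scoped MatrixGroups
open NumberField IsDedekindDomain MeasureTheory Filter

namespace Literature.NumberTheory.Automorphic

open AdelicGroupData
open Literature.NumberTheory.GaloisRepresentations (HeckeCharacter)

variable {F E : Type} [Field F] [NumberField F] [Field E] [NumberField E] [Algebra F E]

/-- **Arthur–Clozel, Ch. 3, (4.1) = (4.2) for one `σ`-stable cuspidal `Π`, as an identity of Hecke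
characters with complex shifts (child of `ArthurClozel1989_exists_cuspidal_descent_of_isGalStable`).**
For a family `μ_k` of automorphic measures on the `GL_k(𝔸_F) ⧸ A_G GL_k(F)` and every
`Gal`-invariant automorphic measure `ν'` on `GL_n(𝔸_E) ⧸ A_G GL_n(E)`: every cuspidal `Π ⊂ L²(ν')`
stable under all `σ ∈ Aut(E/F)` admits a finite set of places `S`, on the `GL_n(𝔸_E) ⋊ σ` side
finitely many characters `χ_{Tᵢ}` of `ℋ_E^S` (families `Tᵢ` of multisets of cardinality `n`,
pairwise distinct off `S`) with coefficients `cᵢ`, among them `T_{i₀} = t_Π` with `c_{i₀} ≠ 0`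
(Jacquet–Shalika (2.4); the twisted side of (17.8)), and on the `GL_n(𝔸_F)` side finitely many
characters `χ_{πⱼ} ∘ b = χ_{N(t_{πⱼ})}` with coefficients `dⱼ`, each `πⱼ` entered through its
cuspidal datum (Langlands 1979, Prop. 2: ranks `k_{j,m} ≥ 1`, `∑ₘ k_{j,m} = n`, cuspidal
`π_{j,m} ⊂ L²_cusp(μ_{k_{j,m}})` with Satake families `α_{j,m}` off a finite `S_F` below the
complement of `S`, complex shifts `s_{j,m}` with `∑ₘ k_{j,m} s_{j,m} = 0`), such that
`∑ᵢ cᵢ χ_{Tᵢ}(φ) = ∑ⱼ dⱼ χ_{N(t_{πⱼ})}(φ)` for every `φ` in the polynomial algebra on the Hecke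
operators `T_{w,i}`, `w ∉ S`, `1 ≤ i ≤ n` (`χ_T(T_{w,i}) = q_w^{i(n-i)/2} e_i(T_w)`; the base change
morphism `b` on unramified classes, Ch. 1 §4: `N(t)_w = (⨆ₘ q_v^{-s_m} α_m(v))^{f(w∣v)}`). This is
the comparison (4.1) = (4.2) of the trace formulae of Ch. 2 (Thms. A, B, (17.8)) for the test
functions `f = (f_S, φ^S)`, `φ = (φ_S, b(φ^S))`, with the bookkeeping of their discrete terms;
verbatim the hypothesis `hspec` of
`arthurClozel1989_exists_cuspidal_descent_of_isGalStable_of_heckeCharacter_identity_cpow`.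
[cite: ArthurClozelAMS120, Ch. 3, (4.1) = (4.2) and proof of Thm. 4.2 (d), pp. 206–207; Ch. 2, (17.8)]
[cite: LanglandsCorvallis1979Notion, Prop. 2] -/
def ArthurClozel1989_traceIdentity_heckeCharacters {n : ℕ}
    (μF : (a : ℕ) → Measure (gl a F).automorphicQuotient)
    [∀ a, (gl a F).IsAutomorphicMeasure (μF a)] : Prop :=
  ∀ (ν' : Measure (gl n E).automorphicQuotient) [(gl n E).IsAutomorphicMeasure ν']
      (hν' : IsGalInvariant F ν') (Q : CuspidalAutomorphicRepGL n E ν'),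
      (∀ σ : E ≃ₐ[F] E, Q.IsGalStable F hν' σ) →
        ∃ (S : Finset (HeightOneSpectrum (𝓞 E)))
          (a : ℕ) (c : Fin a → ℂ) (T : Fin a → SatakeFamily E)
          (_ : ∀ i, ∀ w ∉ (↑S : Set (HeightOneSpectrum (𝓞 E))), Multiset.card (T i w) = n)
          (_ : ∀ i i', (∀ w ∉ (↑S : Set (HeightOneSpectrum (𝓞 E))), T i w = T i' w) → i = i')
          (i₀ : Fin a) (_ : IsSatakeFamilyOf Q ↑S (T i₀)) (_ : c i₀ ≠ 0)
          (b : ℕ) (d : Fin b → ℂ) (r : Fin b → ℕ) (k : (j : Fin b) → Fin (r j) → ℕ)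
          (_ : ∀ j m, 0 < k j m) (_ : ∀ j, ∑ m, k j m = n)
          (P : (j : Fin b) → (m : Fin (r j)) → CuspidalAutomorphicRepGL (k j m) F (μF (k j m)))
          (s : (j : Fin b) → Fin (r j) → ℂ) (_ : ∀ j, ∑ m, (k j m : ℂ) * s j m = 0)
          (SF : Finset (HeightOneSpectrum (𝓞 F)))
          (αF : (j : Fin b) → Fin (r j) → SatakeFamily F)
          (_ : ∀ j m, IsSatakeFamilyOf (P j m) ↑SF (αF j m))
          (_ : ∀ w ∉ (↑S : Set (HeightOneSpectrum (𝓞 E))),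
            w.under (𝓞 F) ∉ (↑SF : Set (HeightOneSpectrum (𝓞 F)))),
          ∀ φ : MvPolynomial
              ({w : HeightOneSpectrum (𝓞 E) // w ∉ (↑S : Set (HeightOneSpectrum (𝓞 E)))} × Fin n) ℂ,
            ∑ i, c i * MvPolynomial.eval
                (fun p : {w : HeightOneSpectrum (𝓞 E) //
                    w ∉ (↑S : Set (HeightOneSpectrum (𝓞 E)))} × Fin n =>
                  ((Real.sqrt (p.1.1.residueCard : ℝ) : ℝ) : ℂ) ^
                      ((p.2.1 + 1) * (n - (p.2.1 + 1))) *
                    (T i p.1.1).esymm (p.2.1 + 1)) φ =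
              ∑ j, d j * MvPolynomial.eval
                (fun p : {w : HeightOneSpectrum (𝓞 E) //
                    w ∉ (↑S : Set (HeightOneSpectrum (𝓞 E)))} × Fin n =>
                  ((Real.sqrt (p.1.1.residueCard : ℝ) : ℝ) : ℂ) ^
                      ((p.2.1 + 1) * (n - (p.2.1 + 1))) *
                    ((∑ m, (αF j m (p.1.1.under (𝓞 F))).map
                      ((((p.1.1.under (𝓞 F)).residueCard : ℂ) ^ (-(s j m))) * ·)).map
                        (· ^ p.1.1.asIdeal.inertiaDeg (𝓞 F))).esymm (p.2.1 + 1)) φ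

/-- **Assembly (PROVED): Thm. 4.2 (d), existence clause, from the trace identity and the
Jacquet–Shalika / multiplicity-one facts** — the tree's
`arthurClozel1989_exists_cuspidal_descent_of_isGalStable_of_heckeCharacter_identity_cpow`
(extraction by independence of characters; cuspidality by pairing an isobaric descent datum with
its conjugate). The `F`-side analytic facts are the existing named facts of `PairLFunctionPoles.lean`
and `multiplicity_one_gl`, granted for the family `μ_k`; (2.3) over `E` in rank `n`.
[cite: ArthurClozelAMS120, Ch. 3, Thm. 4.2 (d), proof, pp. 206–207] -/
theorem ArthurClozel1989_exists_cuspidal_descent_of_isGalStable_holds_of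
    {μF : (a : ℕ) → Measure (gl a F).automorphicQuotient}
    [hμF : ∀ a, (gl a F).IsAutomorphicMeasure (μF a)]
    (h22aF : ∀ a b : ℕ, JacquetShalika1981_partialPairL_boundary_of_ne_one (n := a) (m := b)
      (K := F) (μ := μF a) (μ' := μF b))
    (h22bF : ∀ a b : ℕ, JacquetShalika1981_partialPairL_at_one_of_rank_ne (n := a) (m := b)
      (K := F) (μ := μF a) (μ' := μF b))
    (h22cF : ∀ a : ℕ, JacquetShalika1981_partialPairL_at_one_of_ne_conj (n := a) (K := F)
      (μ := μF a))
    (h23F : ∀ a : ℕ, JacquetShalika1981_partialPairL_pole_of_eq_conj (n := a) (K := F)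
      (μ := μF a))
    (hm1F : ∀ a : ℕ, multiplicity_one_gl a F (μF a))
    {n : ℕ}
    (h23E : ∀ (ν' : Measure (gl n E).automorphicQuotient) [(gl n E).IsAutomorphicMeasure ν'],
      JacquetShalika1981_partialPairL_pole_of_eq_conj (n := n) (K := E) (μ := ν'))
    (hspec : ArthurClozel1989_traceIdentity_heckeCharacters (F := F) (E := E) (n := n) μF) :
    ArthurClozel1989_exists_cuspidal_descent_of_isGalStable (n := n) (F := F) (E := E) :=
  arthurClozel1989_exists_cuspidal_descent_of_isGalStable_of_heckeCharacter_identity_cpow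
    h22aF h22bF h22cF h23F hm1F h23E hspec

end Literature.NumberTheory.Automorphic

end
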